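import Literature.Analysis.ODE.LiouvilleGreenErrorBound
import Literature.Analysis.ODE.LiouvilleGreenOscillatory
import Literature.Geometry.Lorentzian.KerrSurfaceGravity

/-!
# Liouville–Green approximation with Olver's error bounds, large parameter `u`
# (stub `stub_lgErrorBound`, S2 of the line `olver-dunster-uniform-reduction`)

Crux `PhaseMixingCapture.KappaExplicitWaveDecay` (stmt-FinalStateConjecture-10654), line
`olver-dunster-uniform-reduction`, stub S2 — the ENGINE of the line: on every transition-free
stretch of the blown-up radial ODE `W″ = (m² f + g) W` (S1) the LG approximation with Olver's
error-control function `F` gives two explicit solutions with RELATIVE errors bounded by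
`exp(𝒱(F)/u) − 1`, `u = |m|`.

The statement is pure real/complex analysis and is proved in the Literature tree
(`Literature/Analysis/ODE/`, all sorry-free, Mathlib only):

* `LiouvilleGreenVolterraBound.lean` — the abstract a priori bound `norm_lgError_le` (variation
  of parameters against a comparison pair `E″ = (q + ρ)E` with constant Wronskian `c`, then
  Grönwall): `‖w/E₁ − 1‖ ≤ exp((2/‖c‖)∫ m) − 1`, `‖(w/E₁)′‖ ≤ ‖c‖/(2‖E₁‖‖E₂‖)·(same)`, replacing
  Olver's resolvent series for the Volterra equation (Olver 1974, Ch. 6 (2.09), (2.23));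
* `LiouvilleGreenApproximant.lean` — the LG pair `f^{-1/4}e^{±uξ}` (`ξ′ = √f`) solves EXACTLY
  `E″ = (u²f + g + √f·Φ)E`, `Φ = 5f′²/(16f^{5/2}) − f″/(4f^{3/2}) − g/f^{1/2} = F′`, with Wronskian
  `2u` (`2iu` in the oscillatory case) and `|E₊||E₋| = f^{-1/2}`;
* `LiouvilleGreenErrorBound.lean` — (A), `f > 0`:
  `Literature.Analysis.ODE.exists_lgSolutions_of_pos` (Olver Ch. 6 Thm 2.1 + Ch. 10 Thm 3.1,
  constants `exp(𝒱/u) − 1`, `2u√f`);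
* `LiouvilleGreenOscillatory.lean` — (B), `f < 0`:
  `Literature.Analysis.ODE.exists_lgSolution_of_neg` (Olver Ch. 6 Thm 2.2).

This file is the thin wrapper
`stub_lgErrorBound := ⟨exists_lgSolutions_of_pos, exists_lgSolution_of_neg⟩` with the registered
signature copied byte for byte from the skeleton.
-/

-- the doubled `FinalStateConjecture.FinalStateConjecture` path component trips dupNamespace
set_option linter.dupNamespace false

noncomputable section

namespace Summit.FinalStateConjecture.FinalStateConjecture.Theorems.KappaExplicitWaveDecay.OlverDunsterUniformReduction

open Literature.Geometry.Lorentzian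
open MeasureTheory Filter Set Complex
open scoped Topology Manifold ENNReal

/-- **S2 · `stub_lgErrorBound` — Liouville–Green approximation with Olver's error bounds, large
parameter `u`** (Olver, *Asymptotics and Special Functions* (1974), Ch. 6 Thm 2.1 (exponential
case `f > 0`), Thm 2.2 (oscillatory case `f < 0`), Ch. 10 §3 (large parameter) = DLMF §2.7(iii);
stated with the weaker constants `exp(𝒱/u) − 1` and `2u√|f|`). (A) For `u > 0`, `f ∈ C²[α, β]`
positive, `g ∈ C[α, β]`: `w″ = (u²f + g)w` has real solutions `w₁ = f^{-1/4}e^{+u∫_α^x√f}(1 + ε₁)`,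
`w₂ = f^{-1/4}e^{−u∫_α^x√f}(1 + ε₂)`, `ε₁(α) = 0 = ε₂(β)`, `|ε₁(x)| ≤ exp(u⁻¹∫_α^x|Φ|) − 1`,
`|ε₂(x)| ≤ exp(u⁻¹∫_x^β|Φ|) − 1`, `|ε_j′| ≤ 2u√f·(same)`,
`Φ = 5f′²/(16f^{5/2}) − f″/(4f^{3/2}) − g/f^{1/2}`. (B) For `f < 0`: a complex solution
`w = (−f)^{-1/4}e^{iu∫_α^x√(−f)}(1 + ε)`, `ε(α) = 0`, `‖ε(x)‖ ≤ exp(u⁻¹∫_α^x|Φ|) − 1`,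
`‖ε′‖ ≤ 2u√(−f)·(same)`, `Φ = 5f′²/(16(−f)^{5/2}) + f″/(4(−f)^{3/2}) − g/(−f)^{1/2}`.
Proof: `Literature.Analysis.ODE.exists_lgSolutions_of_pos` and
`Literature.Analysis.ODE.exists_lgSolution_of_neg`. -/
theorem stub_lgErrorBound :
    (∀ (u α β : ℝ) (f f' f'' g : ℝ → ℝ), 0 < u → α ≤ β →
        (∀ t ∈ Icc α β, HasDerivAt f (f' t) t ∧ HasDerivAt f' (f'' t) t) →
        ContinuousOn f'' (Icc α β) → ContinuousOn g (Icc α β) → (∀ t ∈ Icc α β, 0 < f t) →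
        ∃ (w₁ w₁' w₂ w₂' ε₁ ε₁' ε₂ ε₂' : ℝ → ℝ),
          (∀ x ∈ Icc α β,
              w₁ x = (f x) ^ (-(1 / 4 : ℝ)) * Real.exp (u * ∫ t in α..x, Real.sqrt (f t)) * (1 + ε₁ x) ∧
              w₂ x = (f x) ^ (-(1 / 4 : ℝ)) * Real.exp (-(u * ∫ t in α..x, Real.sqrt (f t))) * (1 + ε₂ x) ∧
              |ε₁ x| ≤ Real.exp (u⁻¹ * ∫ t in α..x, |5 * f' t ^ 2 / (16 * (f t) ^ (5 / 2 : ℝ)) - f'' t / (4 * (f t) ^ (3 / 2 : ℝ)) - g t / Real.sqrt (f t)|) - 1 ∧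
              |ε₂ x| ≤ Real.exp (u⁻¹ * ∫ t in x..β, |5 * f' t ^ 2 / (16 * (f t) ^ (5 / 2 : ℝ)) - f'' t / (4 * (f t) ^ (3 / 2 : ℝ)) - g t / Real.sqrt (f t)|) - 1 ∧
              |ε₁' x| ≤ 2 * u * Real.sqrt (f x) * (Real.exp (u⁻¹ * ∫ t in α..x, |5 * f' t ^ 2 / (16 * (f t) ^ (5 / 2 : ℝ)) - f'' t / (4 * (f t) ^ (3 / 2 : ℝ)) - g t / Real.sqrt (f t)|) - 1) ∧
              |ε₂' x| ≤ 2 * u * Real.sqrt (f x) * (Real.exp (u⁻¹ * ∫ t in x..β, |5 * f' t ^ 2 / (16 * (f t) ^ (5 / 2 : ℝ)) - f'' t / (4 * (f t) ^ (3 / 2 : ℝ)) - g t / Real.sqrt (f t)|) - 1)) ∧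
          ε₁ α = 0 ∧ ε₂ β = 0 ∧
          ContinuousOn w₁ (Icc α β) ∧ ContinuousOn w₁' (Icc α β) ∧
          ContinuousOn w₂ (Icc α β) ∧ ContinuousOn w₂' (Icc α β) ∧
          (∀ x ∈ Ioo α β,
              HasDerivAt ε₁ (ε₁' x) x ∧ HasDerivAt ε₂ (ε₂' x) x ∧
              HasDerivAt w₁ (w₁' x) x ∧ HasDerivAt w₁' ((u ^ 2 * f x + g x) * w₁ x) x ∧
              HasDerivAt w₂ (w₂' x) x ∧ HasDerivAt w₂' ((u ^ 2 * f x + g x) * w₂ x) x)) ∧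
    (∀ (u α β : ℝ) (f f' f'' g : ℝ → ℝ), 0 < u → α ≤ β →
        (∀ t ∈ Icc α β, HasDerivAt f (f' t) t ∧ HasDerivAt f' (f'' t) t) →
        ContinuousOn f'' (Icc α β) → ContinuousOn g (Icc α β) → (∀ t ∈ Icc α β, f t < 0) →
        ∃ (w w' ε ε' : ℝ → ℂ),
          (∀ x ∈ Icc α β,
              w x = (((-f x) ^ (-(1 / 4 : ℝ)) : ℝ) : ℂ) *
                  Complex.exp (Complex.I * ((u * ∫ t in α..x, Real.sqrt (-f t) : ℝ) : ℂ)) * (1 + ε x) ∧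
              ‖ε x‖ ≤ Real.exp (u⁻¹ * ∫ t in α..x, |5 * f' t ^ 2 / (16 * (-f t) ^ (5 / 2 : ℝ)) + f'' t / (4 * (-f t) ^ (3 / 2 : ℝ)) - g t / Real.sqrt (-f t)|) - 1 ∧
              ‖ε' x‖ ≤ 2 * u * Real.sqrt (-f x) * (Real.exp (u⁻¹ * ∫ t in α..x, |5 * f' t ^ 2 / (16 * (-f t) ^ (5 / 2 : ℝ)) + f'' t / (4 * (-f t) ^ (3 / 2 : ℝ)) - g t / Real.sqrt (-f t)|) - 1)) ∧
          ε α = 0 ∧ ContinuousOn w (Icc α β) ∧ ContinuousOn w' (Icc α β) ∧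
          (∀ x ∈ Ioo α β,
              HasDerivAt ε (ε' x) x ∧ HasDerivAt w (w' x) x ∧
              HasDerivAt w' (((u ^ 2 * f x + g x : ℝ) : ℂ) * w x) x)) :=
  ⟨Literature.Analysis.ODE.exists_lgSolutions_of_pos, Literature.Analysis.ODE.exists_lgSolution_of_neg⟩

end Summit.FinalStateConjecture.FinalStateConjecture.Theorems.KappaExplicitWaveDecay.OlverDunsterUniformReduction
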